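import Literature.Computability.AlgebraicComplexity.VSBRStages
import Literature.Computability.Complexity.FiniteAlphabetGadgets
import HarnessLib

/-!
# Boolean circuits for the Valiant–Skyum–Berkowitz–Rackoff stages over a finite semiring

Trunk T-CPLX-ALG. Continuation of `VSBRStages.lean` towards the named fact (B3)
`Literature.Computability.AlgebraicComplexity.booleanPart_VP_NC_two_of_finite` (Bürgisser 2000 TCS, Thm. 1.1(2), §5 (B) p. 87:
"we start as in (A3) with straight-line programs `Γₙ` of size `n^{O(1)}` and depth `O(log² n)`
using constants in `k` [Thm. 2.5 = VSBR 1983]. As `k` is finite, `Γₙ` can be directly simulated by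
Boolean circuits of size `n^{O(1)}` and depth `O(log² n)`").

For a homogeneous circuit certificate `H` over a FINITE commutative semiring `k` (nodes `ι`,
variables `σ`) and a Boolean input `x : σ → Bool` (evaluation point `bpt x ∈ {0,1}^σ ⊆ k^σ`), the
stage tables `H.tables (eval (bpt x)) i` of `VSBRStages.lean` are computed, in one-hot code
(`FinEnc.enc`, `FiniteAlphabetGadgets.lean`), by `B₂`-circuits of the `NCVec` toolkit
(`NCRealize.lean`):

* stage `0` (`ncVec_baseValues`, `ncVec_baseQuot`, `baseQuotOut_eq`): the values of the nodes of
  formal degree `≤ 1` are affine forms `c₀ + Σⱼ cⱼ xⱼ` of the input bits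
  (`eval_eq_affine_of_totalDegree_le_one`), summed by a balanced tree of addition gadgets (depth
  `O(log #σ)`); the quotients of difference `≤ 1` are constants or one frontier identity over
  constants and these values (`quotTable₀` of `VSBRStages.lean`);
* stage `i + 1` from stage `i` (`ncVec_succMid`, `ncVec_succOut`, `succMidOut_enc`,
  `succOut_enc`): every new entry is a balanced-tree sum over the nodes `w` of ternary gadgets
  `[ν : w] · [w₁] · [w₂]` (resp. `[ν : w] · [light w] · [heavy w : μ]`) on entries of the previous
  (resp. the half-updated) table (depth `O(log #ι)` per stage);
* `stageReal` — all stages, with explicit depth `stageZeroDepth + i · stageDepth` and size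
  `stageZeroSize + i · stageSize`; `entry_inl_eq` — after `⌈log₂ D⌉` stages (`D ≥` all formal
  degrees) every value entry is correct.

## References

* L. G. Valiant, S. Skyum, S. Berkowitz, C. Rackoff, *Fast parallel computation of polynomials
  using few processors*, SIAM J. Comput. 12 (1983) 641–644.
* P. Bürgisser, *Cook's versus Valiant's hypothesis*, Theoret. Comput. Sci. 235 (2000), Thm. 2.5
  and §5 (B).
-/

noncomputable section

namespace Literature.Computability.AlgebraicComplexity.DepthReduction

namespace HomCircuit

open MvPolynomial Finset Complexity Complexity.FinEnc

universe u v w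

/-! ### Polynomials of degree `≤ 1` are affine forms -/

/-- A monomial of degree `≤ 1` is `1` or a variable. [folklore] -/
theorem finsupp_eq_zero_or_single_of_sum_le_one {σ : Type v} (m : σ →₀ ℕ)
    (hm : (m.sum fun _ e => e) ≤ 1) : m = 0 ∨ ∃ j, m = Finsupp.single j 1 := by
  classical
  by_cases h0 : m = 0
  · exact Or.inl h0
  right
  obtain ⟨j, hj⟩ : ∃ j, j ∈ m.support := Finset.nonempty_iff_ne_empty.2 (by simpa using h0)
  have hmj : 1 ≤ m j := Nat.one_le_iff_ne_zero.2 (Finsupp.mem_support_iff.1 hj)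
  have hle : m j ≤ m.sum fun _ e => e := by
    rw [Finsupp.sum]
    exact Finset.single_le_sum (fun _ _ => Nat.zero_le _) hj
  refine ⟨j, Finsupp.ext fun i => ?_⟩
  by_cases hij : i = j
  · subst hij
    rw [Finsupp.single_eq_same]
    omega
  · rw [Finsupp.single_apply, if_neg (fun h => hij h.symm)]
    -- `m i = 0`: otherwise the degree would be `≥ 2`
    by_contra hmi
    have hi : i ∈ m.support := Finsupp.mem_support_iff.2 hmi
    have h2 : m j + m i ≤ m.sum fun _ e => e := by
      have hpair : ∑ l ∈ ({j, i} : Finset σ), m l = m j + m i := Finset.sum_pair (Ne.symm hij)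
      rw [Finsupp.sum, ← hpair]
      exact Finset.sum_le_sum_of_subset_of_nonneg (by
        intro l hl; simp only [Finset.mem_insert, Finset.mem_singleton] at hl
        rcases hl with rfl | rfl <;> assumption) fun _ _ _ => Nat.zero_le _
    have hmi' : 1 ≤ m i := Nat.one_le_iff_ne_zero.2 (Finsupp.mem_support_iff.1 hi)
    omega

/-- **Evaluating a polynomial of total degree `≤ 1`**: `p(g) = p₀ + Σⱼ p_{Xⱼ} · gⱼ`
(the values of the degree-`≤ 1` nodes of a homogeneous circuit are affine forms of the inputs;
Bürgisser 2000 TCS, §5 (A1)/(B): simulating inputs `x ∈ {0,1}ⁿ`). [folklore] -/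
theorem eval_eq_affine_of_totalDegree_le_one {k : Type u} [CommSemiring k] {σ : Type v} [Fintype σ]
    [DecidableEq σ] (p : MvPolynomial σ k) (hp : p.totalDegree ≤ 1) (g : σ → k) :
    eval g p = coeff 0 p + ∑ j, coeff (Finsupp.single j 1) p * g j := by
  classical
  rw [eval_eq']
  -- split the support into `{0}` and the variables
  have hsupp : ∀ m ∈ p.support, m = 0 ∨ ∃ j, m = Finsupp.single j 1 := fun m hm =>
    finsupp_eq_zero_or_single_of_sum_le_one m ((le_totalDegree hm).trans hp)
  have hsplit : p.support ⊆ insert 0 (Finset.univ.image fun j : σ => Finsupp.single j 1) := by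
    intro m hm
    rcases hsupp m hm with rfl | ⟨j, rfl⟩
    · exact Finset.mem_insert_self _ _
    · exact Finset.mem_insert_of_mem (Finset.mem_image.2 ⟨j, Finset.mem_univ _, rfl⟩)
  rw [Finset.sum_subset hsplit (fun m _ hm => by
    rw [MvPolynomial.notMem_support_iff.1 hm, zero_mul])]
  have h0 : (0 : σ →₀ ℕ) ∉ Finset.univ.image fun j : σ => Finsupp.single j 1 := by
    simp only [Finset.mem_image, Finset.mem_univ, true_and, not_exists]
    intro j h
    have := congrArg (fun m => m j) h
    simp at this
  rw [Finset.sum_insert h0]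
  congr 1
  · simp
  · rw [Finset.sum_image fun j _ j' _ h => Finsupp.single_left_injective one_ne_zero h]
    refine Finset.sum_congr rfl fun j _ => ?_
    congr 1
    rw [Finset.prod_eq_single j (fun i _ hij => by
      rw [Finsupp.single_apply, if_neg (fun h => hij h.symm), pow_zero])
      (fun h => absurd (Finset.mem_univ j) h)]
    simp

/-! ### The Boolean point, the entries of the stages, sums over nodes -/

section Stages

variable {k : Type u} {σ : Type v} {ι : Type w} [CommSemiring k] [Fintype k]
variable (H : HomCircuit k σ ι) [DecidableEq ι] [Fintype ι] [Fintype σ] [DecidableEq σ]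

/-- The evaluation point of a Boolean input: `x ↦ (0/1 ∈ k)` coordinatewise (the
`boolPoint` of `BurgisserBooleanParts.lean`). [cite: Burgisser2000TCS, Def. 2.1 p. 75] -/
def bpt (x : σ → Bool) : σ → k := fun j => if x j then 1 else 0

/-- The entries of stage `i` at the Boolean input `x`: values of nodes and quotients of pairs
(the tables of `VSBRStages.lean` at `φ = eval (bpt x)`). [cite: ValiantSkyumBerkowitzRackoff1983] -/
def entry (i : ℕ) (x : σ → Bool) : ι ⊕ (ι × ι) → k
  | .inl ν => (H.tables (eval (bpt x)) i).1 ν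
  | .inr p => (H.tables (eval (bpt x)) i).2 p.1 p.2

omit [DecidableEq ι] [Fintype ι] [Fintype σ] [DecidableEq σ] [Fintype k] in
/-- A polynomial of total degree `0` evaluates to its constant coefficient (the quotients of
degree difference `0` are constants hard-wired into the circuits). [folklore] -/
theorem eval_eq_coeff_zero_of_totalDegree_eq_zero {p : MvPolynomial σ k} (hp : p.totalDegree = 0)
    (g : σ → k) : eval g p = coeff 0 p := by
  conv_lhs => rw [totalDegree_eq_zero_iff_eq_C.1 hp]
  rw [eval_C]

/-- The depth of a balanced-tree sum over the nodes on top of term gadgets of depth `dT`. [folklore] -/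
def sumDepth (nι Q dT : ℕ) : ℕ := dT + Nat.clog 2 nι * (4 * Q + 1)

/-- The size of a balanced-tree sum over the nodes on top of term gadgets of size `sT`. [folklore] -/
def sumSize (nι Q sT : ℕ) : ℕ := nι * sT + (nι - 1) * (Q * univBound (2 * Q))

variable {H}

omit [DecidableEq ι] in
/-- **A code word of a sum over the nodes** from code words of the summands (bundling the term
gadgets, `NCVec.pi_finVec`, and a balanced tree of addition gadgets, `FinEnc.ncVec_sumEnc`). [cite: Burgisser2000TCS, §5 (B) p. 87] -/
theorem ncVec_encSumNodes {κ : Type*} (ν₀ : ι) {t : (κ → Bool) → ι → k} {dT sT : ℕ}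
    (h : ∀ w, NCVec (fun (y : κ → Bool) => enc (t y w)) dT sT) :
    NCVec (fun (y : κ → Bool) => enc (∑ w, t y w)) (sumDepth (Fintype.card ι) (Fintype.card k) dT)
      (sumSize (Fintype.card ι) (Fintype.card k) sT) := by
  haveI : Nonempty k := ⟨0⟩
  set e := Fintype.equivFin ι
  have hM : 1 ≤ Fintype.card ι := Fintype.card_pos_iff.2 ⟨ν₀⟩
  have hpi : NCVec (fun (y : κ → Bool) (p : Fin (Fintype.card ι) × Fin (Fintype.card k)) =>
      enc (t y (e.symm p.1)) p.2) dT (Fintype.card ι * sT) :=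
    NCVec.pi_finVec fun j => h (e.symm j)
  have hs := ncVec_sumEnc (A := k) (a := fun y j => t y (e.symm j)) hM hpi
  refine (hs.congr fun y i => ?_).mono le_rfl le_rfl
  congr 2
  exact Fintype.sum_equiv e.symm _ _ fun _ => rfl

/-! ### Stage `0`: affine forms and the quotients of difference `≤ 1` -/

/-- Depth of the base value layer. [folklore] -/
def baseValDepth (nσ Q : ℕ) : ℕ := 3 + Nat.clog 2 (nσ + 1) * (4 * Q + 1)

/-- Size of the base value layer. [folklore] -/
def baseValSize (nι nσ Q : ℕ) : ℕ :=
  nι * ((nσ + 1) * (Q * univBound 1) + nσ * (Q * univBound (2 * Q)))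

/-- **The values of the nodes of formal degree `≤ 1`** (and `0` elsewhere), in one-hot code:
affine forms `c₀ + Σⱼ cⱼ xⱼ` of the input bits summed by a balanced tree (Bürgisser 2000 TCS,
§5 (B); depth `O(log #σ)`). [cite: Burgisser2000TCS, §5 (B) p. 87] -/
theorem ncVec_baseValues :
    NCVec (fun (x : σ → Bool) (p : ι × Fin (Fintype.card k)) =>
        enc ((H.tables (eval (bpt x)) 0).1 p.1) p.2)
      (baseValDepth (Fintype.card σ) (Fintype.card k))
      (baseValSize (Fintype.card ι) (Fintype.card σ) (Fintype.card k)) := by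
  haveI : Nonempty k := ⟨0⟩
  set eo := (Fintype.equivFin (Option σ)).symm
  have hcard : Fintype.card (Option σ) = Fintype.card σ + 1 := Fintype.card_option
  -- one node
  have hν : ∀ ν : ι, NCVec (fun (x : σ → Bool) => enc ((H.tables (eval (bpt x)) 0).1 ν))
      (baseValDepth (Fintype.card σ) (Fintype.card k))
      ((Fintype.card σ + 1) * ((Fintype.card k) * univBound 1) + Fintype.card σ * ((Fintype.card k) * univBound (2 * (Fintype.card k)))) := by
    intro ν
    change NCVec (fun (x : σ → Bool) => enc (if H.deg ν ≤ 1 then eval (bpt x) (H.val ν) else 0)) _ _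
    by_cases hdeg : H.deg ν ≤ 1
    · simp only [hdeg, if_true]
      -- the summands, indexed by `Option σ` through `eo`
      let a : (σ → Bool) → Fin (Fintype.card (Option σ)) → k := fun x j' =>
        (eo j').elim (coeff 0 (H.val ν)) fun j =>
          if x j then coeff (Finsupp.single j 1) (H.val ν) else 0
      have hterm : ∀ j', NCVec (fun (x : σ → Bool) => enc (a x j')) 3 ((Fintype.card k) * univBound 1) := by
        intro j'
        cases h : eo j' with
        | none =>
          refine ((ncVec_constEnc (coeff 0 (H.val ν))).congr fun x i => ?_).mono (by omega)
            (Nat.le_mul_of_pos_right _ (univBound_pos 1))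
          simp [a, h]
        | some j =>
          refine (ncVec_bitEnc j (0 : k) (coeff (Finsupp.single j 1) (H.val ν))).congr
            fun x i => ?_
          simp [a, h]
      have hpi : NCVec (fun (x : σ → Bool) (p : Fin (Fintype.card (Option σ)) × Fin (Fintype.card k)) =>
          enc (a x p.1) p.2) 3 (Fintype.card (Option σ) * ((Fintype.card k) * univBound 1)) :=
        NCVec.pi_finVec hterm
      have hs := ncVec_sumEnc (A := k) (a := a) (by rw [hcard]; omega) hpi
      refine (hs.congr fun x i => ?_).mono (le_of_eq (by simp [baseValDepth, hcard]))
        (le_of_eq (by simp [hcard]))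
      congr 2
      -- the sum is the affine form, which is the value
      rw [eval_eq_affine_of_totalDegree_le_one (H.val ν) ((H.totalDegree_val_le ν).trans hdeg),
        Fintype.sum_equiv eo (fun j' => a x j') (fun o => o.elim (coeff 0 (H.val ν)) fun j =>
          if x j then coeff (Finsupp.single j 1) (H.val ν) else 0) (fun j' => rfl),
        Fintype.sum_option]
      simp only [Option.elim]
      congr 1
      refine Finset.sum_congr rfl fun j _ => ?_
      simp only [bpt]
      split_ifs <;> simp
    · simp only [hdeg, if_false]
      refine (ncVec_constEnc (0 : k)).mono (by unfold baseValDepth; omega) ?_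
      calc (Fintype.card k) ≤ (Fintype.card k) * univBound 1 := Nat.le_mul_of_pos_right _ (univBound_pos 1)
        _ ≤ (Fintype.card σ + 1) * ((Fintype.card k) * univBound 1) := Nat.le_mul_of_pos_left _ (by omega)
        _ ≤ _ := Nat.le_add_right _ _
  -- all nodes
  set e := Fintype.equivFin ι
  have hpi : NCVec (fun (x : σ → Bool) (p : Fin (Fintype.card ι) × Fin (Fintype.card k)) =>
      enc ((H.tables (eval (bpt x)) 0).1 (e.symm p.1)) p.2) _ _ :=
    NCVec.pi_finVec fun j => hν (e.symm j)
  exact ((hpi.outMap fun p : ι × Fin (Fintype.card k) => (e p.1, p.2)).congr fun x p => by simp).mono le_rfl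
    le_rfl

omit [CommSemiring k] in
/-- Bundling realizations of all outputs `o : O` (vectors of `#k` wires each) into one block
(through an enumeration of `O`). [cite: Vollmer1999, §1.2] -/
theorem ncVec_bundleVec {κ O : Type*} [Fintype O]
    {G : (κ → Bool) → O → Fin (Fintype.card k) → Bool} {d s : ℕ}
    (h : ∀ o, NCVec (fun y => G y o) d s) :
    NCVec (fun (y : κ → Bool) (p : O × Fin (Fintype.card k)) => G y p.1 p.2) d (Fintype.card O * s) := by
  set e := Fintype.equivFin O
  have hpi : NCVec (fun (y : κ → Bool) (p : Fin (Fintype.card O) × Fin (Fintype.card k)) =>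
      G y (e.symm p.1) p.2) d (Fintype.card O * s) :=
    NCVec.pi_finVec fun j => h (e.symm j)
  exact (hpi.outMap fun p : O × Fin (Fintype.card k) => (e p.1, p.2)).congr fun y p => by simp

/-- **A triple product of three input vectors**, in one-hot code: depth `6 #k + 1`, size
`#k · univBound (3 #k)` (the term gadgets of the stages). [cite: Burgisser2000TCS, §5 (B) p. 87] -/
theorem ncVec_tripleTerm {κ : Type*} (u v w : Fin (Fintype.card k) → κ) :
    haveI : Nonempty k := ⟨0⟩
    NCVec (fun (y : κ → Bool) => enc (dec (fun i => y (u i)) * (dec (fun i => y (v i)) *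
        dec (fun i => y (w i)))))
      (6 * Fintype.card k + 1) (Fintype.card k * univBound (3 * Fintype.card k)) := by
  haveI : Nonempty k := ⟨0⟩
  have h := (ncVec_proj (ι := κ) (Sum.elim u (Sum.elim v w))).comp
    (ncVec_terGadget (A := k) fun a b c => a * (b * c))
  refine (h.congr fun y i => ?_).mono (by omega) (by omega)
  rfl

/-! ### Stage `0`, quotient part -/

/-- The raw terms of the quotient base: `[ν : w] · (value of light w) · [heavy w : μ]` read off the
base values `y`, for `w` in the frontier `F_{deg μ}` (else `0`). [cite: ValiantSkyumBerkowitzRackoff1983] -/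
def baseQuotTerm (y : ι × Fin (Fintype.card k) → Bool) (ν μ w : ι) : k :=
  haveI : Nonempty k := ⟨0⟩
  if w ∈ H.frontier (H.deg μ) then
    coeff 0 (H.quot ν w) * (dec (fun i => y (H.light (H.children w).1 (H.children w).2, i)) *
      coeff 0 (H.quot (H.heavy (H.children w).1 (H.children w).2) μ))
  else 0

/-- The raw output of the quotient base gadget on base values `y`. [cite: ValiantSkyumBerkowitzRackoff1983] -/
def baseQuotOut (y : ι × Fin (Fintype.card k) → Bool) (p : ι × ι) : k :=
  if H.deg p.1 - H.deg p.2 = 0 then coeff 0 (H.quot p.1 p.2)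
  else if H.deg p.1 - H.deg p.2 = 1 then ∑ w, H.baseQuotTerm y p.1 p.2 w
  else 0

/-- Depth of the quotient base gadget. [folklore] -/
def baseQuotDepth (nι Q : ℕ) : ℕ := sumDepth nι Q (2 * Q + 1)

/-- Size of the quotient base gadget (per pair). [folklore] -/
def baseQuotSize (nι Q : ℕ) : ℕ := sumSize nι Q (Q * univBound Q) + Q

omit [Fintype σ] [DecidableEq σ] in
/-- **The quotient base gadget**: on the code words of the base values, the code words of
`baseQuotOut` (constants, or balanced-tree sums of unary gadgets). [cite: Burgisser2000TCS, §5 (B) p. 87] -/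
theorem ncVec_baseQuot (p : ι × ι) :
    NCVec (fun (y : ι × Fin (Fintype.card k) → Bool) => enc (H.baseQuotOut y p))
      (baseQuotDepth (Fintype.card ι) (Fintype.card k))
      (baseQuotSize (Fintype.card ι) (Fintype.card k)) := by
  haveI : Nonempty k := ⟨0⟩
  obtain ⟨ν, μ⟩ := p
  have hQ : Fintype.card k ≤ baseQuotSize (Fintype.card ι) (Fintype.card k) := Nat.le_add_left _ _
  have hd1 : 1 ≤ baseQuotDepth (Fintype.card ι) (Fintype.card k) := by
    unfold baseQuotDepth sumDepth; omega
  unfold baseQuotOut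
  by_cases h0 : H.deg ν - H.deg μ = 0
  · simp only [h0, if_true]
    exact (ncVec_constEnc _).mono hd1 hQ
  by_cases h1 : H.deg ν - H.deg μ = 1
  · simp only [h1, if_true]
    have hterm : ∀ w, NCVec (fun (y : ι × Fin (Fintype.card k) → Bool) =>
        enc (H.baseQuotTerm y ν μ w)) (2 * Fintype.card k + 1) (Fintype.card k * univBound (Fintype.card k)) := by
      intro w
      unfold baseQuotTerm
      by_cases hw : w ∈ H.frontier (H.deg μ)
      · simp only [hw, if_true]
        have h := (ncVec_proj (ι := ι × Fin (Fintype.card k))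
          fun i => (H.light (H.children w).1 (H.children w).2, i)).comp
          (ncVec_unGadget (A := k) fun a => coeff 0 (H.quot ν w) * (a *
            coeff 0 (H.quot (H.heavy (H.children w).1 (H.children w).2) μ)))
        exact (h.congr fun y i => rfl).mono (by omega) (by omega)
      · simp only [hw, if_false]
        exact (ncVec_constEnc _).mono (by omega)
          (Nat.le_mul_of_pos_right _ (univBound_pos _))
    exact (ncVec_encSumNodes ν hterm).mono le_rfl (Nat.le_add_right _ _)
  · simp only [h0, h1, if_false]
    exact (ncVec_constEnc _).mono hd1 hQ

omit [Fintype σ] [DecidableEq σ] in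
/-- **Correctness of the quotient base gadget** on the code words of the base values:
`baseQuotOut = quotTable₀` (the only decoded input is the base value of `light w`). [cite: ValiantSkyumBerkowitzRackoff1983] -/
theorem baseQuotOut_eq (x : σ → Bool) (ν μ : ι) :
    H.baseQuotOut (fun q => enc ((H.tables (eval (bpt x)) 0).1 q.1) q.2) (ν, μ) =
      H.quotTable₀ (eval (bpt x)) ν μ := by
  haveI : Nonempty k := ⟨0⟩
  unfold baseQuotOut quotTable₀
  simp only
  by_cases h0 : H.deg ν - H.deg μ = 0
  · simp only [h0, if_true]
    exact (eval_eq_coeff_zero_of_totalDegree_eq_zero (Nat.eq_zero_of_le_zero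
      ((H.totalDegree_quot_le ν μ).trans h0.le)) _).symm
  by_cases h1 : H.deg ν - H.deg μ = 1
  · simp only [h1, if_true]
    rw [← Finset.sum_filter_add_sum_filter_not Finset.univ (· ∈ H.frontier (H.deg μ))]
    rw [Finset.sum_eq_zero (s := Finset.univ.filter fun w => ¬w ∈ H.frontier (H.deg μ))
      (fun w hw => by
        simp only [Finset.mem_filter, Finset.mem_univ, true_and] at hw
        simp [baseQuotTerm, hw]), add_zero]
    rw [show (Finset.univ.filter fun w => w ∈ H.frontier (H.deg μ)) = H.frontier (H.deg μ) by
      ext w; simp]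
    refine Finset.sum_congr rfl fun w hw => ?_
    simp only [baseQuotTerm, hw, if_true]
    have henc : (fun i => enc ((H.tables (eval (bpt x)) 0).1
        (H.light (H.children w).1 (H.children w).2)) i) =
        enc ((H.tables (eval (bpt x)) 0).1 (H.light (H.children w).1 (H.children w).2)) := rfl
    rw [henc, FinEnc.dec_enc]
    obtain ⟨hkind, hwm, h1m, h2m⟩ := H.of_mem_frontier hw
    have hνw : H.deg ν ≤ H.deg w := by omega
    rw [eval_eq_coeff_zero_of_totalDegree_eq_zero (Nat.eq_zero_of_le_zero
        ((H.totalDegree_quot_le ν w).trans (by omega))),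
      eval_eq_coeff_zero_of_totalDegree_eq_zero (Nat.eq_zero_of_le_zero
        ((H.totalDegree_quot_le _ μ).trans (by
          have := H.deg_heavy_le_of h1m h2m; omega)))]
    rfl
  · simp only [h0, h1, if_false]

/-! ### Stage `i + 1` from stage `i` -/

/-- The raw value terms of stage `i + 1`: `[ν : w] · [w₁] · [w₂]` read off the entries `y` of stage
`i`, for `w ∈ F_{2ⁱ}` (else `0`). [cite: ValiantSkyumBerkowitzRackoff1983] -/
def succValTerm (i : ℕ) (y : (ι ⊕ (ι × ι)) × Fin (Fintype.card k) → Bool) (ν w : ι) : k :=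
  haveI : Nonempty k := ⟨0⟩
  if w ∈ H.frontier (2 ^ i) then
    dec (fun q => y (.inr (ν, w), q)) *
      (dec (fun q => y (.inl (H.children w).1, q)) * dec (fun q => y (.inl (H.children w).2, q)))
  else 0

/-- The raw output of the first half of stage `i + 1` (new values, old quotients). [cite: ValiantSkyumBerkowitzRackoff1983] -/
def succMidOut (i : ℕ) (y : (ι ⊕ (ι × ι)) × Fin (Fintype.card k) → Bool) :
    (ι ⊕ (ι × ι)) × Fin (Fintype.card k) → Bool
  | (.inl ν, q) => if H.deg ν ≤ 2 ^ i then y (.inl ν, q) else enc (∑ w, H.succValTerm i y ν w) q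
  | (.inr p, q) => y (.inr p, q)

/-- The raw quotient terms of stage `i + 1`: `[ν : w] · [light w] · [heavy w : μ]` read off the
half-updated entries `z`, for `w ∈ F_m`, `m = deg μ + 2ⁱ − 1` (else `0`). [cite: ValiantSkyumBerkowitzRackoff1983] -/
def succQuotTerm (i : ℕ) (z : (ι ⊕ (ι × ι)) × Fin (Fintype.card k) → Bool) (ν μ w : ι) : k :=
  haveI : Nonempty k := ⟨0⟩
  if w ∈ H.frontier (H.deg μ + 2 ^ i - 1) then
    dec (fun q => z (.inr (ν, w), q)) *
      (dec (fun q => z (.inl (H.light (H.children w).1 (H.children w).2), q)) *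
        dec (fun q => z (.inr (H.heavy (H.children w).1 (H.children w).2, μ), q)))
  else 0

/-- The raw output of stage `i + 1` from the half-updated entries. [cite: ValiantSkyumBerkowitzRackoff1983] -/
def succOut (i : ℕ) (z : (ι ⊕ (ι × ι)) × Fin (Fintype.card k) → Bool) :
    (ι ⊕ (ι × ι)) × Fin (Fintype.card k) → Bool
  | (.inl ν, q) => z (.inl ν, q)
  | (.inr (ν, μ), q) => if H.deg ν - H.deg μ ≤ 2 ^ i then z (.inr (ν, μ), q)
      else enc (∑ w, H.succQuotTerm i z ν μ w) q

/-- Depth of one half-stage. [folklore] -/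
def halfDepth (nι Q : ℕ) : ℕ := sumDepth nι Q (6 * Q + 1)

/-- Size of one half-stage (per output). [folklore] -/
def halfSize (nι Q : ℕ) : ℕ := sumSize nι Q (Q * univBound (3 * Q)) + Q

omit [Fintype σ] [DecidableEq σ] in
/-- **The first half-stage gadget** (new values by triple products and balanced sums; Bürgisser
2000 TCS §5 (B), VSBR 1983). [cite: Burgisser2000TCS, §5 (B) p. 87] [cite: ValiantSkyumBerkowitzRackoff1983] -/
theorem ncVec_succMid (i : ℕ) :
    NCVec (fun y => H.succMidOut i y) (halfDepth (Fintype.card ι) (Fintype.card k))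
      (Fintype.card (ι ⊕ (ι × ι)) * halfSize (Fintype.card ι) (Fintype.card k)) := by
  haveI : Nonempty k := ⟨0⟩
  refine ncVec_bundleVec (G := fun y o q => H.succMidOut i y (o, q)) fun o => ?_
  rcases o with ν | p
  · by_cases hν : H.deg ν ≤ 2 ^ i
    · refine ((ncVec_proj fun q : Fin (Fintype.card k) => ((Sum.inl ν : ι ⊕ (ι × ι)), q)).congr
        fun y q => ?_).mono (Nat.zero_le _) (Nat.zero_le _)
      simp [succMidOut, hν]
    · have hterm : ∀ w, NCVec (fun (y : (ι ⊕ (ι × ι)) × Fin (Fintype.card k) → Bool) =>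
          enc (H.succValTerm i y ν w)) (6 * Fintype.card k + 1)
          (Fintype.card k * univBound (3 * Fintype.card k)) := by
        intro w
        unfold succValTerm
        by_cases hw : w ∈ H.frontier (2 ^ i)
        · simp only [hw, if_true]
          exact ncVec_tripleTerm _ _ _
        · simp only [hw, if_false]
          exact (ncVec_constEnc _).mono (by omega) (Nat.le_mul_of_pos_right _ (univBound_pos _))
      refine ((ncVec_encSumNodes ν hterm).congr fun y q => ?_).mono le_rfl (Nat.le_add_right _ _)
      simp [succMidOut, hν]
  · refine ((ncVec_proj fun q : Fin (Fintype.card k) => ((Sum.inr p : ι ⊕ (ι × ι)), q)).congr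
      fun y q => ?_).mono (Nat.zero_le _) (Nat.zero_le _)
    simp [succMidOut]

omit [Fintype σ] [DecidableEq σ] in
/-- **The second half-stage gadget** (new quotients). [cite: Burgisser2000TCS, §5 (B) p. 87] [cite: ValiantSkyumBerkowitzRackoff1983] -/
theorem ncVec_succOut (i : ℕ) :
    NCVec (fun z => H.succOut i z) (halfDepth (Fintype.card ι) (Fintype.card k))
      (Fintype.card (ι ⊕ (ι × ι)) * halfSize (Fintype.card ι) (Fintype.card k)) := by
  haveI : Nonempty k := ⟨0⟩
  refine ncVec_bundleVec (G := fun z o q => H.succOut i z (o, q)) fun o => ?_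
  rcases o with ν | ⟨ν, μ⟩
  · refine ((ncVec_proj fun q : Fin (Fintype.card k) => ((Sum.inl ν : ι ⊕ (ι × ι)), q)).congr
      fun z q => ?_).mono (Nat.zero_le _) (Nat.zero_le _)
    simp [succOut]
  · by_cases hδ : H.deg ν - H.deg μ ≤ 2 ^ i
    · refine ((ncVec_proj fun q : Fin (Fintype.card k) => ((Sum.inr (ν, μ) : ι ⊕ (ι × ι)), q)).congr
        fun z q => ?_).mono (Nat.zero_le _) (Nat.zero_le _)
      simp [succOut, hδ]
    · have hterm : ∀ w, NCVec (fun (z : (ι ⊕ (ι × ι)) × Fin (Fintype.card k) → Bool) =>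
          enc (H.succQuotTerm i z ν μ w)) (6 * Fintype.card k + 1)
          (Fintype.card k * univBound (3 * Fintype.card k)) := by
        intro w
        unfold succQuotTerm
        by_cases hw : w ∈ H.frontier (H.deg μ + 2 ^ i - 1)
        · simp only [hw, if_true]
          exact ncVec_tripleTerm _ _ _
        · simp only [hw, if_false]
          exact (ncVec_constEnc _).mono (by omega) (Nat.le_mul_of_pos_right _ (univBound_pos _))
      refine ((ncVec_encSumNodes ν hterm).congr fun z q => ?_).mono le_rfl (Nat.le_add_right _ _)
      simp [succOut, hδ]

/-- The entries after the first half-stage: new values, old quotients. [cite: ValiantSkyumBerkowitzRackoff1983] -/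
def midEntry (i : ℕ) (x : σ → Bool) : ι ⊕ (ι × ι) → k
  | .inl ν => (H.tables (eval (bpt x)) (i + 1)).1 ν
  | .inr p => (H.tables (eval (bpt x)) i).2 p.1 p.2

omit [Fintype k] [Fintype σ] [DecidableEq σ] in
/-- Sums over all nodes of frontier-supported terms are sums over the frontier. [folklore] -/
theorem sum_ite_mem_frontier {m : ℕ} (f : ι → k) :
    ∑ w, (if w ∈ H.frontier m then f w else 0) = ∑ w ∈ H.frontier m, f w := by
  rw [← Finset.sum_filter]
  congr 1
  ext w
  simp

omit [Fintype σ] [DecidableEq σ] in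
/-- **Correctness of the first half-stage** on the code words of stage `i`. [cite: ValiantSkyumBerkowitzRackoff1983] -/
theorem succMidOut_enc (i : ℕ) (x : σ → Bool) :
    H.succMidOut i (fun p => enc (H.entry i x p.1) p.2) = fun p => enc (H.midEntry i x p.1) p.2 := by
  haveI : Nonempty k := ⟨0⟩
  funext ⟨o, q⟩
  rcases o with ν | p
  · simp only [succMidOut, midEntry, H.tables_succ_fst]
    by_cases hν : H.deg ν ≤ 2 ^ i
    · simp [hν, entry]
    · simp only [hν, if_false]
      congr 1
      unfold succValTerm
      simp only [entry]
      have hd : ∀ (o : ι ⊕ (ι × ι)), (fun q' => enc (H.entry i x o) q') = enc (H.entry i x o) :=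
        fun _ => rfl
      simp only [entry] at hd
      rw [← H.sum_ite_mem_frontier]
      refine Finset.sum_congr rfl fun w _ => ?_
      split_ifs
      · erw [FinEnc.dec_enc, FinEnc.dec_enc, FinEnc.dec_enc]
      · rfl
  · rfl

omit [Fintype σ] [DecidableEq σ] in
/-- **Correctness of the second half-stage** on the code words of the half-updated entries. [cite: ValiantSkyumBerkowitzRackoff1983] -/
theorem succOut_enc (i : ℕ) (x : σ → Bool) :
    H.succOut i (fun p => enc (H.midEntry i x p.1) p.2) = fun p => enc (H.entry (i + 1) x p.1) p.2 := by
  haveI : Nonempty k := ⟨0⟩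
  funext ⟨o, q⟩
  rcases o with ν | ⟨ν, μ⟩
  · rfl
  · simp only [succOut, entry, H.tables_succ_snd]
    by_cases hδ : H.deg ν - H.deg μ ≤ 2 ^ i
    · simp [hδ, midEntry]
    · simp only [hδ, if_false]
      congr 1
      unfold succQuotTerm
      rw [← H.sum_ite_mem_frontier]
      refine Finset.sum_congr rfl fun w _ => ?_
      split_ifs
      · erw [FinEnc.dec_enc, FinEnc.dec_enc, FinEnc.dec_enc]
        rfl
      · rfl

/-! ### All stages -/

/-- Depth of the stage-`0` block. [folklore] -/
def stageZeroDepth (nι nσ Q : ℕ) : ℕ := baseValDepth nσ Q + baseQuotDepth nι Q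

/-- Size of the stage-`0` block. [folklore] -/
def stageZeroSize (nι nσ Q : ℕ) : ℕ := baseValSize nι nσ Q + (nι * nι) * baseQuotSize nι Q

/-- Depth of one stage. [folklore] -/
def stageDepth (nι Q : ℕ) : ℕ := halfDepth nι Q + halfDepth nι Q

/-- Size of one stage. [folklore] -/
def stageSize (nι Q : ℕ) : ℕ := 2 * ((nι + nι * nι) * halfSize nι Q)

/-- **The Boolean circuits of the VSBR stages**: stage `i` of the parallel evaluation of the
homogeneous circuit `H` at the Boolean input `x` — all node values of formal degree `≤ 2ⁱ` and all
gate quotients of degree difference `≤ 2ⁱ`, in one-hot code — is realized by `B₂`-circuits of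
depth `stageZeroDepth + i · stageDepth` (`= O(log #σ) + i · O(log #ι)` for fixed `#k`) and size
`stageZeroSize + i · stageSize` (Bürgisser 2000 TCS, Thm. 2.5 / §5 (B); VSBR 1983). [cite: Burgisser2000TCS, Thm. 2.5 p. 77 and §5 (B) p. 87] [cite: ValiantSkyumBerkowitzRackoff1983] -/
theorem stageReal : ∀ i : ℕ,
    NCVec (fun (x : σ → Bool) (p : (ι ⊕ (ι × ι)) × Fin (Fintype.card k)) => enc (H.entry i x p.1) p.2)
      (stageZeroDepth (Fintype.card ι) (Fintype.card σ) (Fintype.card k) +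
        i * stageDepth (Fintype.card ι) (Fintype.card k))
      (stageZeroSize (Fintype.card ι) (Fintype.card σ) (Fintype.card k) +
        i * stageSize (Fintype.card ι) (Fintype.card k))
  | 0 => by
    -- base values, then (passthrough ⊕ base quotients)
    have hV := H.ncVec_baseValues
    have hQ : NCVec (fun (y : ι × Fin (Fintype.card k) → Bool) (p : (ι × ι) × Fin (Fintype.card k)) =>
        enc (H.baseQuotOut y p.1) p.2) _ _ :=
      ncVec_bundleVec (G := fun y o q => enc (H.baseQuotOut y o) q) fun p => H.ncVec_baseQuot p
    have hmix := (ncVec_proj (ι := ι × Fin (Fintype.card k)) _root_.id).pair hQ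
    have h := hV.comp hmix
    refine ((h.outMap fun p : (ι ⊕ (ι × ι)) × Fin (Fintype.card k) => match p with
      | (.inl ν, q) => Sum.inl (ν, q)
      | (.inr pr, q) => Sum.inr (pr, q)).congr fun x p => ?_).mono ?_ ?_
    · rcases p with ⟨ν | ⟨ν, μ⟩, q⟩
      · rfl
      · simp only [Sum.elim_inr, entry]
        congr 1
        exact H.baseQuotOut_eq x ν μ
    · simp [stageZeroDepth]
    · simp [stageZeroSize, Fintype.card_prod]
  | i + 1 => by
    have ih := stageReal i
    have h := ih.comp ((H.ncVec_succMid i).comp (H.ncVec_succOut i))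
    refine (h.congr fun x p => ?_).mono (le_of_eq ?_) (le_of_eq ?_)
    · have h1 := H.succMidOut_enc i x
      have h2 := H.succOut_enc i x
      change H.succOut i (H.succMidOut i fun p => enc (H.entry i x p.1) p.2) p = _
      rw [h1, h2]
    · simp only [stageDepth]; ring
    · simp only [stageSize, Fintype.card_sum, Fintype.card_prod]; ring

omit [Fintype k] [Fintype σ] [DecidableEq σ] in
/-- **All values after `⌈log₂ D⌉` stages**: if every formal degree is `≤ D`, stage `⌈log₂ D⌉`
carries the code word of `[ν](x)` for every node `ν`. [cite: ValiantSkyumBerkowitzRackoff1983] -/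
theorem entry_inl_eq {D : ℕ} (hD : ∀ ν, H.deg ν ≤ D) (x : σ → Bool) (ν : ι) :
    H.entry (Nat.clog 2 D) x (.inl ν) = eval (bpt x) (H.val ν) := by
  simp only [entry]
  exact H.tables_fst_eq_of_clog _ ((Nat.clog_mono_right 2 (hD ν)))

end Stages

end HomCircuit

end Literature.Computability.AlgebraicComplexity.DepthReduction
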